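import Summits.Ventures.DiscreteObjects.Hadamard.NegaPairItoQuadruple
import Literature.Combinatorics.Designs.WilliamsonArray

/-!
# Williamson sequences of odd length t ⇔ REVERSAL-SYMMETRIC negaperiodic Golay pairs of length 2t (kernel)

Framing: lottery ticket; floor = certified bounds/negative ranges.

Cell pub-namedobj (venture DiscreteObjects), target (H), hadamard gen 23; companion of `NegaPairItoQuadruple` (Balonin–Đoković
2015 §9: NGP(2t) ⇔ quasi-Williamson quadruple of order t, t odd) for the SYMMETRIC sub-case.  In the antiperiodic form on
`ℤ/n`, `n = 4t` (gen 19's convention: `u (x + 2t) = −u x`, `PAF_u + PAF_v = 0` off `{0, 2t}`), call a sequence REVERSAL-SYMMETRIC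
if `u(−x) = (−1)^{x.val} u(x)` (well defined, `n` even).  Along the CRT `ℤ/4t ≃ ℤ/4 × ℤ/t` (first component = residue mod 4,
which carries the parity) this is exactly the symmetry of the two halves `a = u(0,·)`, `b = u(1,·)`:
* `crt_parity` (odd `t`, `n = 4t`): a ring isomorphism `f : ZMod n ≃+* ZMod 4 × ZMod t` with `f (2t) = (2, 0)`,
  `(f x).1 = x.val (mod 4)`, hence `(f x).1 = 0 / 2 ⇒ (−1)^{x.val} = 1` and `(f x).1 = 1 / 3 ⇒ (−1)^{x.val} = −1`.
* **`williamsonSequences_of_symmetric_negaPair`**: a reversal-symmetric antiperiodic complementary pair `u, v` on `ℤ/4t` yields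
  WILLIAMSON SEQUENCES `a, b, c, d` of length `t` (symmetric `±1`, `Σ PAF = 0` off `0`) — `a, c` from the coset `0`, `b, d` from
  the coset `1` (`b(−j) = u(f⁻¹(1,−j)) = u(−f⁻¹(3,j)) = −u(f⁻¹(3,j)) = u(f⁻¹(1,j))`).
* **`symmetric_negaPair_of_williamsonSequences`**: conversely Williamson sequences glue (as `(a, b, −a, −b)`, `(c, d, −c, −d)` on
  the four cosets) to a reversal-symmetric antiperiodic complementary pair (for symmetric circulants the amicability
  `A Bᵀ + C Dᵀ = B Aᵀ + D Cᵀ` is automatic, `circT_of_symm` + `circulant_mul_comm`).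
* **`williamsonSequences_iff_symmetric_negaPair`** (odd `t`): the iff.  At `t = 167` this is the sequence-level content of
  `Order334InvertingFixedWilliamson668` (an order-334 element inverted by a row-fixing automorphism makes gen 19's pair
  reversal-symmetric): **`williamsonSequences167_iff_symmetric_negaPair334`**.
Dictionary between two encodings of the same open object (Williamson sequences of length 167 / Williamson-type NG-pairs of
length 334); replication-adjacent (Williamson ⊂ quasi-Williamson ⇔ NG-pairs, Balonin–Đoković 2015 §9; Ito 2000); ours; no
`sorry`, no definitions, default heartbeats.
-/

namespace Summit.Ventures.DiscreteObjects.Hadamard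

open Finset BigOperators Matrix

open Literature.Combinatorics.Designs.GoethalsSeidel (IsHadamardMatrix circT)
open Literature.Combinatorics.Designs.LegendrePairs (PAF IsPM)
open Literature.Combinatorics.Designs.Williamson (circT_of_symm)

section crt
variable {n t : ℕ} [NeZero n] [NeZero t]

omit [NeZero n] in
/-- **the CRT with parities** (odd `t`, `n = 4t`): `f : ZMod n ≃+* ZMod 4 × ZMod t`, `f(2t) = (2,0)`, and the first component
decides the sign `(−1)^{x.val}`. -/
lemma crt_parity (hn : n = 4 * t) (ht : Odd t) :
    ∃ f : ZMod n ≃+* ZMod 4 × ZMod t, f ((2 * t : ℕ) : ZMod n) = (2, 0) ∧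
      (∀ x : ZMod n, (f x).1 = 0 → (-1 : ℤ) ^ x.val = 1) ∧ (∀ x : ZMod n, (f x).1 = 1 → (-1 : ℤ) ^ x.val = -1) ∧
      (∀ x : ZMod n, (f x).1 = 2 → (-1 : ℤ) ^ x.val = 1) ∧ (∀ x : ZMod n, (f x).1 = 3 → (-1 : ℤ) ^ x.val = -1) := by
  haveI : NeZero n := ⟨by rw [hn]; exact Nat.mul_ne_zero (by norm_num) (NeZero.ne t)⟩
  have hcop : Nat.Coprime 4 t := (Nat.coprime_two_left.mpr ht).pow_left 2
  let f : ZMod n ≃+* ZMod 4 × ZMod t := (ZMod.ringEquivCongr hn).trans (ZMod.chineseRemainder hcop)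
  have hval : ∀ x : ZMod n, (f x).1 = ((x.val : ℕ) : ZMod 4) := fun x => by
    conv_lhs => rw [← ZMod.natCast_zmod_val x, map_natCast]
    rfl
  have hmod : ∀ (x : ZMod n) (k : ℕ), k < 4 → (f x).1 = (k : ZMod 4) → x.val % 4 = k := fun x k hk h => by
    rw [hval, ZMod.natCast_eq_natCast_iff'] at h
    rw [h, Nat.mod_eq_of_lt hk]
  have hev : ∀ x : ZMod n, x.val % 2 = 0 → (-1 : ℤ) ^ x.val = 1 := fun x h =>
    (Nat.even_iff.mpr h).neg_one_pow
  have hod : ∀ x : ZMod n, x.val % 2 = 1 → (-1 : ℤ) ^ x.val = -1 := fun x h =>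
    (Nat.odd_iff.mpr h).neg_one_pow
  refine ⟨f, ?_, fun x hx => hev x ?_, fun x hx => hod x ?_, fun x hx => hev x ?_, fun x hx => hod x ?_⟩
  · have h2 : (2 * t) % 4 = 2 := by obtain ⟨k, rfl⟩ := ht; omega
    rw [map_natCast]
    ext
    · rw [Prod.fst_natCast, ← ZMod.natCast_mod (2 * t) 4, h2, Nat.cast_ofNat]
    · rw [Prod.snd_natCast, Nat.cast_mul, ZMod.natCast_self, mul_zero]
  · have := hmod x 0 (by norm_num) (by rw [hx, Nat.cast_zero]); omega
  · have := hmod x 1 (by norm_num) (by rw [hx, Nat.cast_one]); omega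
  · have := hmod x 2 (by norm_num) (by rw [hx]; norm_num); omega
  · have := hmod x 3 (by norm_num) (by rw [hx]; norm_num); omega

end crt

section main
variable {n t : ℕ} [NeZero n] [NeZero t]

/-- **Reversal-symmetric negaperiodic Golay pair ⇒ Williamson sequences** (odd `t`, `n = 4t`). -/
theorem williamsonSequences_of_symmetric_negaPair (hn : n = 4 * t) (ht : Odd t) (u v : ZMod n → ℤ)
    (hu : IsPM u) (hv : IsPM v) (hua : ∀ x, u (x + (2 * t : ℕ)) = -u x) (hva : ∀ x, v (x + (2 * t : ℕ)) = -v x)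
    (hur : ∀ x, u (-x) = (-1) ^ x.val * u x) (hvr : ∀ x, v (-x) = (-1) ^ x.val * v x)
    (hp : ∀ s : ZMod n, s ≠ 0 → s ≠ (2 * t : ℕ) → PAF u s + PAF v s = 0) :
    ∃ a b c d : ZMod t → ℤ, IsPM a ∧ IsPM b ∧ IsPM c ∧ IsPM d ∧ (∀ i, a (-i) = a i) ∧ (∀ i, b (-i) = b i) ∧
      (∀ i, c (-i) = c i) ∧ (∀ i, d (-i) = d i) ∧
      ∀ s : ZMod t, s ≠ 0 → PAF a s + PAF b s + PAF c s + PAF d s = 0 := by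
  obtain ⟨f, hf2t, hf0, _, _, hf3⟩ := crt_parity hn ht
  have hfh : f.symm (2, 0) = ((2 * t : ℕ) : ZMod n) := by rw [← hf2t, f.symm_apply_apply]
  have hsplit : ∀ (w : ZMod n → ℤ), (∀ x, w (x + (2 * t : ℕ)) = -w x) →
      ∀ k j, w (f.symm (k + 2, j)) = -w (f.symm (k, j)) := fun w hw k j => by
    rw [show ((k + 2, j) : ZMod 4 × ZMod t) = (k, j) + (2, 0) by rw [Prod.mk_add_mk, add_zero], map_add, hfh, hw]
  have hsymm0 : ∀ (w : ZMod n → ℤ), (∀ x, w (-x) = (-1) ^ x.val * w x) →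
      ∀ j : ZMod t, w (f.symm (0, -j)) = w (f.symm (0, j)) := fun w hw j => by
    have hneg : f.symm (0, -j) = -f.symm (0, j) := by rw [← map_neg, Prod.neg_mk, neg_zero]
    rw [hneg, hw, hf0 _ (by rw [f.apply_symm_apply]), one_mul]
  have hsymm1 : ∀ (w : ZMod n → ℤ), (∀ x, w (-x) = (-1) ^ x.val * w x) → (∀ x, w (x + (2 * t : ℕ)) = -w x) →
      ∀ j : ZMod t, w (f.symm (1, -j)) = w (f.symm (1, j)) := fun w hw hw' j => by
    have hneg : f.symm (1, -j) = -f.symm (3, j) := by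
      rw [← map_neg, Prod.neg_mk, show (-3 : ZMod 4) = 1 by decide]
    rw [hneg, hw, hf3 _ (by rw [f.apply_symm_apply]), show ((3 : ZMod 4), j) = ((1 : ZMod 4) + 2, j) by
      rw [show (1 : ZMod 4) + 2 = 3 by decide], hsplit w hw' 1 j]
    ring
  have hU : ∀ k j, u (f.symm (k + 2, j)) = -u (f.symm (k, j)) := hsplit u hua
  have hV : ∀ k j, v (f.symm (k + 2, j)) = -v (f.symm (k, j)) := hsplit v hva
  have hPu : ∀ q : ZMod 4 × ZMod t, PAF u (f.symm q) = ∑ p, u (f.symm p) * u (f.symm (p + q)) := fun q => by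
    rw [paf_transport f.toAddEquiv u]
    show ∑ p, u (f.symm p) * u (f.symm (p + f (f.symm q))) = _
    rw [f.apply_symm_apply]
  have hPv : ∀ q : ZMod 4 × ZMod t, PAF v (f.symm q) = ∑ p, v (f.symm p) * v (f.symm (p + q)) := fun q => by
    rw [paf_transport f.toAddEquiv v]
    show ∑ p, v (f.symm p) * v (f.symm (p + f (f.symm q))) = _
    rw [f.apply_symm_apply]
  have hE1 : ∀ r : ZMod t, r ≠ 0 →
      PAF (fun j => u (f.symm (0, j))) r + PAF (fun j => u (f.symm (1, j))) r +
        PAF (fun j => v (f.symm (0, j))) r + PAF (fun j => v (f.symm (1, j))) r = 0 := by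
    intro r hr
    have hne0 : f.symm (0, r) ≠ 0 := fun h0 => by
      have h1 := congrArg f h0
      rw [f.apply_symm_apply, map_zero] at h1
      exact hr (by simpa using congrArg Prod.snd h1)
    have hne2 : f.symm (0, r) ≠ ((2 * t : ℕ) : ZMod n) := fun h0 => by
      have h1 := congrArg f h0
      rw [f.apply_symm_apply, hf2t, Prod.mk.injEq] at h1
      exact absurd h1.1 (by decide)
    have h0 := hp (f.symm (0, r)) hne0 hne2
    rw [hPu, hPv, sum_antiperiodic_shift0 (fun p => u (f.symm p)) hU r,
      sum_antiperiodic_shift0 (fun p => v (f.symm p)) hV r] at h0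
    linarith
  exact ⟨fun j => u (f.symm (0, j)), fun j => u (f.symm (1, j)), fun j => v (f.symm (0, j)), fun j => v (f.symm (1, j)),
    fun j => hu _, fun j => hu _, fun j => hv _, fun j => hv _,
    hsymm0 u hur, hsymm1 u hur hua, hsymm0 v hvr, hsymm1 v hvr hva, hE1⟩

/-- for symmetric `±1` sequences the circulants are amicable: `A Bᵀ + C Dᵀ = B Aᵀ + D Cᵀ` -/
lemma amicable_of_symm (a b c d : ZMod t → ℤ) (ha : ∀ i, a (-i) = a i) (hb : ∀ i, b (-i) = b i) (hc : ∀ i, c (-i) = c i)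
    (hd : ∀ i, d (-i) = d i) :
    circulant a * circT b + circulant c * circT d = circulant b * circT a + circulant d * circT c := by
  rw [circT_of_symm a ha, circT_of_symm b hb, circT_of_symm c hc, circT_of_symm d hd, Matrix.circulant_mul_comm a b,
    Matrix.circulant_mul_comm c d]

/-- **Williamson sequences ⇒ a reversal-symmetric negaperiodic Golay pair** (odd `t`, `n = 4t`): glue `(a, b, −a, −b)` and
`(c, d, −c, −d)` on the four cosets mod 4. -/
theorem symmetric_negaPair_of_williamsonSequences (hn : n = 4 * t) (ht : Odd t) (a b c d : ZMod t → ℤ)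
    (ha : IsPM a) (hb : IsPM b) (hc : IsPM c) (hd : IsPM d) (has : ∀ i, a (-i) = a i) (hbs : ∀ i, b (-i) = b i)
    (hcs : ∀ i, c (-i) = c i) (hds : ∀ i, d (-i) = d i)
    (hs : ∀ r : ZMod t, r ≠ 0 → PAF a r + PAF b r + PAF c r + PAF d r = 0) :
    ∃ u v : ZMod n → ℤ, IsPM u ∧ IsPM v ∧ (∀ x, u (x + (2 * t : ℕ)) = -u x) ∧ (∀ x, v (x + (2 * t : ℕ)) = -v x) ∧
      (∀ x, u (-x) = (-1) ^ x.val * u x) ∧ (∀ x, v (-x) = (-1) ^ x.val * v x) ∧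
      ∀ s : ZMod n, s ≠ 0 → s ≠ (2 * t : ℕ) → PAF u s + PAF v s = 0 := by
  obtain ⟨f, hf2t, hf0, hf1, hf2, hf3⟩ := crt_parity hn ht
  have zmod4_cases : ∀ k : ZMod 4, k = 0 ∨ k = 1 ∨ k = 2 ∨ k = 3 := by decide
  -- the glued functions on `ℤ/4 × ℤ/t`
  set W : (ZMod t → ℤ) → (ZMod t → ℤ) → ZMod 4 × ZMod t → ℤ := fun x y p =>
    if p.1 = 0 then x p.2 else if p.1 = 1 then y p.2 else if p.1 = 2 then -x p.2 else -y p.2 with hW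
  have W0 : ∀ x y j, W x y (0, j) = x j := fun x y j => by
    rw [hW]; dsimp only; rw [if_pos rfl]
  have W1 : ∀ x y j, W x y (1, j) = y j := fun x y j => by
    rw [hW]; dsimp only; rw [if_neg (show (1 : ZMod 4) ≠ 0 by decide), if_pos rfl]
  have W2 : ∀ x y j, W x y (2, j) = -x j := fun x y j => by
    rw [hW]; dsimp only
    rw [if_neg (show (2 : ZMod 4) ≠ 0 by decide), if_neg (show (2 : ZMod 4) ≠ 1 by decide), if_pos rfl]
  have W3 : ∀ x y j, W x y (3, j) = -y j := fun x y j => by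
    rw [hW]; dsimp only
    rw [if_neg (show (3 : ZMod 4) ≠ 0 by decide), if_neg (show (3 : ZMod 4) ≠ 1 by decide),
      if_neg (show (3 : ZMod 4) ≠ 2 by decide)]
  have Wanti : ∀ x y k j, W x y (k + 2, j) = -W x y (k, j) := fun x y k j => by
    rcases zmod4_cases k with rfl | rfl | rfl | rfl
    · rw [zero_add, W2, W0]
    · rw [show (1 : ZMod 4) + 2 = 3 by decide, W3, W1]
    · rw [show (2 : ZMod 4) + 2 = 0 by decide, W0, W2, neg_neg]
    · rw [show (3 : ZMod 4) + 2 = 1 by decide, W1, W3, neg_neg]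
  -- reversal symmetry of the glued function for symmetric `x, y`
  have Wrefl : ∀ x y, (∀ i, x (-i) = x i) → (∀ i, y (-i) = y i) → ∀ z : ZMod n,
      W x y (f (-z)) = (-1) ^ z.val * W x y (f z) := by
    intro x y hx hy z
    rw [map_neg]
    obtain ⟨k, j, hkj⟩ : ∃ (k : ZMod 4) (j : ZMod t), f z = (k, j) := ⟨(f z).1, (f z).2, rfl⟩
    rw [hkj, Prod.neg_mk]
    rcases zmod4_cases k with rfl | rfl | rfl | rfl
    · rw [neg_zero, W0, W0, hx, hf0 z (by rw [hkj]), one_mul]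
    · rw [show (-1 : ZMod 4) = 3 by decide, W3, W1, hy, hf1 z (by rw [hkj])]; ring
    · rw [show (-2 : ZMod 4) = 2 by decide, W2, W2, hx, hf2 z (by rw [hkj]), one_mul]
    · rw [show (-3 : ZMod 4) = 1 by decide, W1, W3, hy, hf3 z (by rw [hkj])]; ring
  -- the negaperiodic pair from `NegaPairItoQuadruple`'s gluing is exactly `W a b ∘ f`, `W c d ∘ f`; we redo the three checks
  have Wpm : ∀ x y, IsPM x → IsPM y → ∀ p, W x y p = 1 ∨ W x y p = -1 := by
    intro x y hx hy p
    obtain ⟨k, j⟩ := p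
    have hneg : ∀ z : ℤ, (z = 1 ∨ z = -1) → (-z = 1 ∨ -z = -1) := fun z hz => by
      rcases hz with rfl | rfl <;> norm_num
    rcases zmod4_cases k with rfl | rfl | rfl | rfl
    · rw [W0]; exact hx j
    · rw [W1]; exact hy j
    · rw [W2]; exact hneg _ (hx j)
    · rw [W3]; exact hneg _ (hy j)
  have hfh : f.symm (2, 0) = ((2 * t : ℕ) : ZMod n) := by rw [← hf2t, f.symm_apply_apply]
  have hanti : ∀ x y (z : ZMod n), W x y (f (z + (2 * t : ℕ))) = -W x y (f z) := fun x y z => by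
    have h1 : f (z + (2 * t : ℕ)) = ((f z).1 + 2, (f z).2) := by rw [map_add, hf2t]; ext <;> simp
    rw [h1, Wanti]
  have hE2 : ∀ r : ZMod t, ∑ m, a m * b (m + r) + ∑ m, c m * d (m + r) = ∑ m, b m * a (m + r) + ∑ m, d m * c (m + r) := by
    intro r
    have h0 := congrFun (congrFun (amicable_of_symm a b c d has hbs hcs hds) 0) r
    rw [Matrix.add_apply, Matrix.add_apply, circulant_mul_circT_apply', circulant_mul_circT_apply',
      circulant_mul_circT_apply', circulant_mul_circT_apply', sub_zero] at h0
    exact h0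
  refine ⟨fun z => W a b (f z), fun z => W c d (f z), fun z => Wpm a b ha hb (f z), fun z => Wpm c d hc hd (f z),
    hanti a b, hanti c d, Wrefl a b has hbs, Wrefl c d hcs hds, fun s hs0 hsh => ?_⟩
  obtain ⟨σ, r, rfl⟩ : ∃ (σ : ZMod 4) (r : ZMod t), s = f.symm (σ, r) := ⟨(f s).1, (f s).2, by
    rw [Prod.mk.eta, f.symm_apply_apply]⟩
  have hPu : PAF (fun z => W a b (f z)) (f.symm (σ, r)) = ∑ p, W a b p * W a b (p + (σ, r)) := by
    rw [paf_transport f.toAddEquiv]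
    show ∑ p, W a b (f (f.symm p)) * W a b (f (f.symm (p + f (f.symm (σ, r))))) = _
    simp only [f.apply_symm_apply]
  have hPv : PAF (fun z => W c d (f z)) (f.symm (σ, r)) = ∑ p, W c d p * W c d (p + (σ, r)) := by
    rw [paf_transport f.toAddEquiv]
    show ∑ p, W c d (f (f.symm p)) * W c d (f (f.symm (p + f (f.symm (σ, r))))) = _
    simp only [f.apply_symm_apply]
  rw [hPu, hPv]
  rcases zmod4_cases σ with rfl | rfl | rfl | rfl
  · have hr : r ≠ 0 := fun hr => hs0 (by rw [hr]; simp)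
    rw [sum_antiperiodic_shift0 (W a b) (Wanti a b) r, sum_antiperiodic_shift0 (W c d) (Wanti c d) r]
    simp only [W0, W1]
    have := hs r hr
    linarith
  · rw [sum_antiperiodic_shift1 (W a b) (Wanti a b) r, sum_antiperiodic_shift1 (W c d) (Wanti c d) r]
    simp only [W0, W1]
    have := hE2 r
    linarith
  · have hr : r ≠ 0 := fun hr => hsh (by rw [hr, hfh])
    rw [sum_antiperiodic_shift2 (W a b) (Wanti a b) r, sum_antiperiodic_shift2 (W c d) (Wanti c d) r]
    simp only [W0, W1]
    have := hs r hr
    linarith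
  · rw [sum_antiperiodic_shift3 (W a b) (Wanti a b) r, sum_antiperiodic_shift3 (W c d) (Wanti c d) r]
    simp only [W0, W1]
    have := hE2 r
    linarith

/-- **Williamson sequences of odd length `t` ⇔ reversal-symmetric negaperiodic Golay pairs of length `2t`** (antiperiodic
form on `ℤ/4t`). -/
theorem williamsonSequences_iff_symmetric_negaPair (hn : n = 4 * t) (ht : Odd t) :
    (∃ a b c d : ZMod t → ℤ, IsPM a ∧ IsPM b ∧ IsPM c ∧ IsPM d ∧ (∀ i, a (-i) = a i) ∧ (∀ i, b (-i) = b i) ∧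
      (∀ i, c (-i) = c i) ∧ (∀ i, d (-i) = d i) ∧ ∀ s : ZMod t, s ≠ 0 → PAF a s + PAF b s + PAF c s + PAF d s = 0) ↔
    ∃ u v : ZMod n → ℤ, IsPM u ∧ IsPM v ∧ (∀ x, u (x + (2 * t : ℕ)) = -u x) ∧ (∀ x, v (x + (2 * t : ℕ)) = -v x) ∧
      (∀ x, u (-x) = (-1) ^ x.val * u x) ∧ (∀ x, v (-x) = (-1) ^ x.val * v x) ∧
      ∀ s : ZMod n, s ≠ 0 → s ≠ (2 * t : ℕ) → PAF u s + PAF v s = 0 := by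
  constructor
  · rintro ⟨a, b, c, d, ha, hb, hc, hd, has, hbs, hcs, hds, hs⟩
    exact symmetric_negaPair_of_williamsonSequences hn ht a b c d ha hb hc hd has hbs hcs hds hs
  · rintro ⟨u, v, hu, hv, hua, hva, hur, hvr, hp⟩
    exact williamsonSequences_of_symmetric_negaPair hn ht u v hu hv hua hva hur hvr hp

end main

/-- **Williamson sequences of length 167 ⇔ reversal-symmetric negaperiodic Golay pairs of length 334** (the sequence-level
content of `Order334InvertingFixedWilliamson668`). -/
theorem williamsonSequences167_iff_symmetric_negaPair334 :
    (∃ a b c d : ZMod 167 → ℤ, IsPM a ∧ IsPM b ∧ IsPM c ∧ IsPM d ∧ (∀ i, a (-i) = a i) ∧ (∀ i, b (-i) = b i) ∧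
      (∀ i, c (-i) = c i) ∧ (∀ i, d (-i) = d i) ∧ ∀ s : ZMod 167, s ≠ 0 → PAF a s + PAF b s + PAF c s + PAF d s = 0) ↔
    ∃ u v : ZMod 668 → ℤ, IsPM u ∧ IsPM v ∧ (∀ x, u (x + 334) = -u x) ∧ (∀ x, v (x + 334) = -v x) ∧
      (∀ x, u (-x) = (-1) ^ x.val * u x) ∧ (∀ x, v (-x) = (-1) ^ x.val * v x) ∧
      ∀ s : ZMod 668, s ≠ 0 → s ≠ 334 → PAF u s + PAF v s = 0 := by
  have h := williamsonSequences_iff_symmetric_negaPair (n := 668) (t := 167) (by norm_num) ⟨83, by norm_num⟩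
  rw [show ((2 * 167 : ℕ) : ZMod 668) = 334 by norm_num] at h
  exact h

end Summit.Ventures.DiscreteObjects.Hadamard
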